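import Summits.QuantumFields.YangMills.Theorems.LuscherReductionTwistedTraceScalingToronZeroMode
import HarnessLib

/-!
# Negative lemma R9 (spectral form) for crux `TwistedTraceScaling` (stmt-QuantumFields-20203): the stiff remainder of the toron zero-point sum is NOT gapped on
# the whole flat valley — the gap closes exactly at the non-trivial toron points `θ_k = π/L` — and it IS uniformly gapped on the trivial toron cell

Standing disprover `ym-cdisprove-20203-1` (gen 9); companion of `Negative/ConstProximityCentreTwist.lean` (near-CONSTANT `S^α`-proximity false at even `L`),
written in lane A's valley coordinates (`…ToronZeroMode`: `restZPE L κ α = Σ_{j ≠ 0} modeZPE(κ·lap3 L α j)`, `α = 2θ`, background `V_θ = abelianCfg L θ`).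
Lane A's `gap_le_lap3` gaps the remainder AT `α = 0` (`lap3 L 0 j ≥ 2 − 2cos(2π/L)`, `j ≠ 0`) and the Born–Oppenheimer text treats it as a smooth, stiff
correction along the valley.  Kernel-checked here:
* (i) `lap3_halfTwist_eq_zero`, `exists_fast_zero_mode`: at `α⋆ = (0, 0, 2π/L)` — the valley point `θ⋆ = (0,0,π/L)`, whose direction-2 holonomy is
  `(e^{iπσ₃/L})^L = −1`, i.e. the NON-TRIVIAL toron point of `Negative/ConstProximityCentreTwist.lean` — the NON-zero momentum `j⋆ = (0,0,L−1)` has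
  `lap3 L α⋆ j⋆ = 0` for every `L ≥ 2`: the «fast» window contains an exact zero mode (the spiral), `restZPE` has a vanishing term (`restZPE_term_eq_zero`),
  and no uniform stiffness holds along the valley.  (At odd `L` this point is a gauge copy of the CENTRAL constant `θ₂ = π`, where the zero modes are constants;
  at even `L` it is not — `R9.constProximity_rpow_false`.)
* (ii) `cell_gap_le_lap1`, ★ `cell_gap_le_lap3`, `modeZPE_cell_gap_le`: on the trivial toron CELL `|α_k| ≤ π/L` (i.e. `|θ_k| ≤ π/(2L)`) the remainder is
  uniformly gapped, `lap3 L α j ≥ 2 − 2cos(π/L) > 0` for `j ≠ 0` (`cell_gap_pos`, `L ≥ 2`) — the sharp cell: (i) sits on its boundary's far side.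
Message (BO-vs-BH pre-vet, COARSE(L₀) bricks c6/C3d): run the stiff window on the trivial cell only and reach the other seven cells by the centre twists
(translations `θ_k ↦ θ_k + π/L` of the valley torus; `wilsonAction_twist_of_mem_center`, `IsPhys.zeroFlux`), instead of continuing the `α = 0` gap along the valley.
## WHAT THIS IS NOT
Trigonometric bookkeeping at fixed `L` on the Negative/ lane (`--supports stmt-QuantumFields-20203`); not `¬TwistedTraceScaling`, no stub touched.  HONEST
FRAMING: femto rung R2b1, stub support of a child of a CONDITIONAL reduction route; not a gap, not Clay.  Sorry-free, no new definition; axioms ⊆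
{propext, Classical.choice, Quot.sound}.
-/

set_option autoImplicit false

noncomputable section

open Finset
open scoped BigOperators
open Summit.QuantumFields.YangMills.Theorems.FemtoTransferGap
open Summit.QuantumFields.YangMills.Theorems.FemtoTransferGap.TwoLattice.Toron

namespace Summit.QuantumFields.YangMills.Theorems.TwistedTraceScaling.Negative.R9

variable (L : ℕ) [NeZero L]

/-! ## §1 The gap closes at the non-trivial toron point `θ⋆ = (0,0,π/L)` -/

omit [NeZero L] in
/-- The momentum `L − 1` kills the doubled half twist: `2 − 2cos(2π/L + 2π(L−1)/L) = 2 − 2cos 2π = 0`. [folklore] -/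
theorem lap1_halfTwist_eq_zero (hL : 2 ≤ L) : lap1 L (2 * Real.pi / L) ⟨L - 1, by omega⟩ = 0 := by
  unfold lap1
  have hL0 : (L : ℝ) ≠ 0 := by exact_mod_cast (show L ≠ 0 by omega)
  have h : 2 * Real.pi / L + 2 * Real.pi * (((⟨L - 1, by omega⟩ : Fin L) : ℕ) : ℝ) / L = 0 + (1 : ℕ) * (2 * Real.pi) := by
    simp only [Nat.cast_one, one_mul, zero_add]
    rw [Nat.cast_sub (by omega), Nat.cast_one]
    field_simp
    ring
  rw [h, Real.cos_add_nat_mul_two_pi, Real.cos_zero]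
  ring

omit [NeZero L] in
/-- Zero twist, zero momentum: `lap1 L 0 0 = 0`. [folklore] -/
theorem lap1_zero_zero (hL : 2 ≤ L) : lap1 L 0 ⟨0, by omega⟩ = 0 := by
  simp [lap1]

omit [NeZero L] in
/-- ★ **The fast window is not gapped on the valley**: at `α⋆ = (0,0,2π/L)` the NON-zero momentum `j⋆ = (0,0,L−1)` has `lap3 L α⋆ j⋆ = 0` (`L ≥ 2`). [folklore] -/
theorem lap3_halfTwist_eq_zero (hL : 2 ≤ L) :
    lap3 L (fun k => if k = 2 then 2 * Real.pi / L else 0) (fun k => if k = 2 then ⟨L - 1, by omega⟩ else ⟨0, by omega⟩) = 0 := by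
  unfold lap3
  rw [Fin.sum_univ_three]
  simp only [Fin.isValue, show (0 : Fin 3) ≠ 2 by decide, show (1 : Fin 3) ≠ 2 by decide, if_false, if_true]
  rw [lap1_halfTwist_eq_zero L hL, lap1_zero_zero L hL]
  ring

/-- The momentum `j⋆ = (0,0,L−1)` is NOT the zero momentum (`L ≥ 2`). [folklore] -/
theorem jStar_ne_zero (hL : 2 ≤ L) : (fun k : Fin 3 => if k = 2 then (⟨L - 1, by omega⟩ : Fin L) else ⟨0, by omega⟩) ≠ 0 := by
  intro h
  have h2 := congrFun h 2
  simp only [Fin.isValue, if_true] at h2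
  have h3 : L - 1 = 0 := by simpa using congrArg Fin.val h2
  omega

/-- ★ **Existence form**: for every `L ≥ 2` there are a valley point `α` and a non-zero momentum `j` with `lap3 L α j = 0` — `restZPE L κ α` then has a
vanishing term, so NO bound `restZPE`-term `≥ modeZPE(κ·g)`, `g > 0`, holds uniformly in `α`. [folklore] -/
theorem exists_fast_zero_mode (hL : 2 ≤ L) : ∃ (α : Fin 3 → ℝ) (j : Fin 3 → Fin L), j ≠ 0 ∧ lap3 L α j = 0 :=
  ⟨_, _, jStar_ne_zero L hL, lap3_halfTwist_eq_zero L hL⟩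

omit [NeZero L] in
/-- Hence the corresponding term of the remainder `restZPE` vanishes: `modeZPE(κ·lap3 L α⋆ j⋆) = 0`. [folklore] -/
theorem restZPE_term_eq_zero (hL : 2 ≤ L) (κ : ℝ) :
    modeZPE (κ * lap3 L (fun k => if k = 2 then 2 * Real.pi / L else 0) (fun k => if k = 2 then ⟨L - 1, by omega⟩ else ⟨0, by omega⟩)) = 0 := by
  rw [lap3_halfTwist_eq_zero L hL, mul_zero, modeZPE_zero]

/-- ★ **No uniform gap along the valley**: there is no `g > 0` with `g ≤ lap3 L α j` for all `α` and all `j ≠ 0` (`L ≥ 2`). [folklore] -/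
theorem not_uniform_gap (hL : 2 ≤ L) : ¬ ∃ g : ℝ, 0 < g ∧ ∀ (α : Fin 3 → ℝ) (j : Fin 3 → Fin L), j ≠ 0 → g ≤ lap3 L α j := by
  rintro ⟨g, hg, h⟩
  obtain ⟨α, j, hj, h0⟩ := exists_fast_zero_mode L hL
  have := h α j hj
  rw [h0] at this
  linarith

/-! ## §2 The uniform gap on the trivial toron cell `|α_k| ≤ π/L` -/

/-- On the cell, a non-zero momentum component is gapped: `|a| ≤ π/L`, `i ≠ 0` ⇒ `2 − 2cos(π/L) ≤ lap1 L a i`. [folklore] -/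
theorem cell_gap_le_lap1 (hL : 2 ≤ L) {a : ℝ} (ha : |a| ≤ Real.pi / L) {i : Fin L} (hi : i ≠ 0) :
    2 - 2 * Real.cos (Real.pi / L) ≤ lap1 L a i := by
  unfold lap1
  have hL' : (2 : ℝ) ≤ L := by exact_mod_cast hL
  have hLpos : (0 : ℝ) < L := by linarith
  have hπ := Real.pi_pos
  have hi1 : (1 : ℝ) ≤ (i : ℕ) := by
    have : 1 ≤ (i : ℕ) := Nat.one_le_iff_ne_zero.mpr (fun h => hi (Fin.ext h))
    exact_mod_cast this
  have hiL : ((i : ℕ) : ℝ) ≤ L - 1 := by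
    have : (((i : ℕ) + 1 : ℕ) : ℝ) ≤ L := by exact_mod_cast i.isLt
    push_cast at this; linarith
  obtain ⟨ha1, ha2⟩ := abs_le.mp ha
  set x : ℝ := a + 2 * Real.pi * (i : ℕ) / L with hx
  -- `π/L ≤ x ≤ 2π − π/L`
  have hx1 : Real.pi / L ≤ x := by
    have : 2 * Real.pi / L ≤ 2 * Real.pi * (i : ℕ) / L := by
      rw [div_le_div_iff_of_pos_right hLpos]; nlinarith
    have e : Real.pi / L = -(Real.pi / L) + 2 * Real.pi / L := by ring
    rw [e]; linarith
  have hx2 : x ≤ 2 * Real.pi - Real.pi / L := by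
    have : 2 * Real.pi * (i : ℕ) / L ≤ 2 * Real.pi * (L - 1) / L := by
      rw [div_le_div_iff_of_pos_right hLpos]; nlinarith
    have e : 2 * Real.pi * ((L : ℝ) - 1) / L = 2 * Real.pi - 2 * Real.pi / L := by field_simp
    rw [e] at this
    have e2 : 2 * Real.pi - Real.pi / L = Real.pi / L + (2 * Real.pi - 2 * Real.pi / L) := by ring
    rw [e2]; linarith
  have hπL : Real.pi / L ≤ Real.pi := by rw [div_le_iff₀ hLpos]; nlinarith
  suffices h : Real.cos x ≤ Real.cos (Real.pi / L) by linarith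
  by_cases hhalf : x ≤ Real.pi
  · exact Real.cos_le_cos_of_nonneg_of_le_pi (by positivity) hhalf hx1
  · push Not at hhalf
    have hsym : Real.cos x = Real.cos (2 * Real.pi - x) := by
      rw [show 2 * Real.pi - x = -x + (1 : ℕ) * (2 * Real.pi) by push_cast; ring, Real.cos_add_nat_mul_two_pi, Real.cos_neg]
    rw [hsym]
    exact Real.cos_le_cos_of_nonneg_of_le_pi (by positivity) (by linarith) (by linarith)

/-- ★ **Uniform gap on the trivial toron cell**: `|α_k| ≤ π/L` for all `k` and `j ≠ 0` ⇒ `2 − 2cos(π/L) ≤ lap3 L α j`. [folklore] -/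
theorem cell_gap_le_lap3 (hL : 2 ≤ L) {α : Fin 3 → ℝ} (hα : ∀ k, |α k| ≤ Real.pi / L) {j : Fin 3 → Fin L} (hj : j ≠ 0) :
    2 - 2 * Real.cos (Real.pi / L) ≤ lap3 L α j := by
  obtain ⟨k, hk⟩ := Function.ne_iff.mp hj
  unfold lap3
  calc 2 - 2 * Real.cos (Real.pi / L) ≤ lap1 L (α k) (j k) := cell_gap_le_lap1 L hL (hα k) hk
    _ ≤ ∑ k', lap1 L (α k') (j k') := single_le_sum (fun k' _ => lap1_nonneg L _ _) (mem_univ k)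

omit [NeZero L] in
/-- The cell gap is positive for `L ≥ 2`. [folklore] -/
theorem cell_gap_pos (hL : 2 ≤ L) : 0 < 2 - 2 * Real.cos (Real.pi / L) := by
  have hL' : (2 : ℝ) ≤ L := by exact_mod_cast hL
  have h1 : 0 < Real.pi / L := by positivity
  have h2 : Real.pi / L ≤ Real.pi := by rw [div_le_iff₀ (by linarith)]; nlinarith [Real.pi_pos]
  have h3 : Real.cos (Real.pi / L) < Real.cos 0 := Real.cos_lt_cos_of_nonneg_of_le_pi le_rfl h2 h1
  rw [Real.cos_zero] at h3
  linarith

/-- Hence every remainder mode is uniformly stiff on the cell: `modeZPE(κ·(2 − 2cos(π/L))) ≤ modeZPE(κ·lap3 L α j)` (`κ ≥ 0`, `j ≠ 0`, `|α_k| ≤ π/L`). [folklore] -/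
theorem modeZPE_cell_gap_le (hL : 2 ≤ L) {κ : ℝ} (hκ : 0 ≤ κ) {α : Fin 3 → ℝ} (hα : ∀ k, |α k| ≤ Real.pi / L) {j : Fin 3 → Fin L} (hj : j ≠ 0) :
    modeZPE (κ * (2 - 2 * Real.cos (Real.pi / L))) ≤ modeZPE (κ * lap3 L α j) :=
  modeZPE_le_modeZPE (mul_nonneg hκ (cell_gap_pos L hL).le) (mul_le_mul_of_nonneg_left (cell_gap_le_lap3 L hL hα hj) hκ)

omit [NeZero L] in
/-- **Sharpness of the cell**: the zero of §1 sits at `α⋆₂ = 2π/L`, outside the cell `|α_k| ≤ π/L` by a factor `2` (`L ≥ 2`). [folklore] -/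
theorem halfTwist_not_mem_cell (hL : 2 ≤ L) : ¬ ∀ k : Fin 3, |(fun k : Fin 3 => if k = 2 then 2 * Real.pi / (L : ℝ) else 0) k| ≤ Real.pi / L := by
  intro h
  have h2 := h 2
  simp only [Fin.isValue, if_true] at h2
  have hLpos : (0 : ℝ) < L := by exact_mod_cast (show 0 < L by omega)
  rw [abs_of_nonneg (by positivity), div_le_div_iff_of_pos_right hLpos] at h2
  linarith [Real.pi_pos]

end Summit.QuantumFields.YangMills.Theorems.TwistedTraceScaling.Negative.R9

end
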